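import Literature.MathematicalPhysics.QuantumFieldTheory.Balaban1983to89.B7Prop5GeneralLevels
import Literature.MathematicalPhysics.QuantumFieldTheory.Balaban1983to89.B7Prop6GeneralAnalytic

/-!
# `Balaban1983to89.B7Prop5LineDerivFiniteFamily` — T. Bałaban, *Averaging operations for lattice gauge theories*, Commun. Math. Phys. **98** (1985)
17–51 [Balaban1985Averaging], Sect. E (137) p. 39, (150) p. 40, Proposition 4 p. 38: **THE LINE DERIVATIVE (137) OF THE REMAINDER `C_k(U₀, ·)(c)`
ALONG A FINITE SUM OF DIRECTIONS IS THE SUM OF THE LINE DERIVATIVES** (Gateaux-linearity on finite families, at a general regular background) —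
the bookkeeping step that turns Proposition 5's single-bond differentials `dC_k(B; X·δ_b)(c)` into the differential along any finitely supported
direction; used by the sequel `B11Eq44CKernelColumnTower` to read Prop. 5 (157) on PERIODIC (torus) fields, where one torus bond has `2^d` images

statement-level skeleton of published theorems with citation tags; proofs where landed; nothing here is a claim about the Yang–Mills mass gap

PDF held: `paper:balaban1985-cmp98-averaging` (journal page = PDF page + 16), p. 39 [PDF 23] through the verbatim quotations of `B7Prop5GeneralInduction`
((137): *«dF(A, δA) = (d/dt) F(A + tδA)|_{t=0} (137) is a linear functional of the variable δA»*) and p. 38 (Prop. 4's analyticity clause) through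
`B7Prop6GeneralAnalytic`.

WHAT IS PROVED (sorry-free; no definition; nothing of the paper asserted).  Print's sentence «is a linear functional of the variable δA» for the
remainder `C_j(U₀, ·)(c)` (`B7Prop5GeneralInduction.CCovIter`, (150)) on FINITE families of directions, at a general regular background in [4] Prop. 4's
regime (the hypotheses of `B7Eq123General.prop4_general`: `2 ≤ L`, `U₀` `G`-valued with `AvgClosed G`, (52), `C₀α₀ ≤ 1/3`, `4α₀ ≤ c₂′`, `sup‖B‖ ≤ a`,
`e^{4cα₀}(1 + 8C₁Lᵏa) ≤ 2`, `2Lᵏa ≤ c₃`):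
* §1 **`linCovIter_family`** — the composed linear part `LʲηQ_j(U₀)·` is affine along every finite family: `LʲηQ_j(U₀)(B + Σ_iσ_iD_i) = LʲηQ_j(U₀)B +
  Σ_iσ_i·LʲηQ_j(U₀)D_i` (`B7Prop5GeneralLinear.linCovIter_line` iterated; additivity∕homogeneity binders as there).
* §2 **`lineDeriv_CCovIter_sum`** — `σ ↦ C_k(U₀, B + Σ_iσ_iD_i)(c)` is differentiable at `σ = 0` (the composite (127) is analytic along bondwise-analytic
  families, `B7Prop6GeneralAnalytic.prop4_general_analyticAt`; the linear part is affine, §1, with `hadd_levels`∕`hsmul_levels`), and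
  `lineDeriv ℂ (C_k(U₀, ·)(c)) B (Σ_iD_i) = Σ_i dC_k(B; D_i)(c)` (`dCov`).
HONEST SCOPE.  Mechanism only ([folklore] calculus on the crews' objects); no estimate of the paper is used or claimed; NOT summit progress (cell
pub-balaban: NE9 NOT PRINTED ∕ NOT PROVED; spine PROVED 0∕9; rung (B)+1 on a finite T⁴ — NOT infinite volume, NOT mass gap, NOT Clay).  Filed by the NE9
crux-team leaf seat `b2b-balaban-t4-ne9-formalise-leaf-01` (gen 97); NEW file; imports `B7Prop5GeneralLevels`, `B7Prop6GeneralAnalytic`; nothing modified.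
-/

noncomputable section

open scoped BigOperators
open Finset Metric Set

namespace Literature.MathematicalPhysics.QuantumFieldTheory.Balaban1983to89.B7Prop5LineDerivFiniteFamily

open B7Prop2Explicit (pdev AvgClosed C0 c2')
open B7Prop3Flat (c3)
open B7Prop4GeneralLevels (logCovIter linCovIter)
open B7Prop5GeneralInduction (CCovIter dCov)
open B7Prop5GeneralLevels (hadd_levels hsmul_levels)
open B7Prop5GeneralLinear (linCovIter_line)
open B7Prop6GeneralAnalytic (prop4_general_analyticAt)

-- `Site` alone would resolve to the torus sites of `Setup.lean`; re-export the `ℤ^d` sites of `B7Prop1Explicit`.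
export B7Prop1Explicit (Site)

variable {d : ℕ}

/-! ## §1 The composed linear part along a finite family of directions -/

section Family

variable {𝔸 : Type*} [NormedRing 𝔸] [NormedAlgebra ℂ 𝔸] [CompleteSpace 𝔸]
variable (L : ℕ) (U₀ : Site d → Fin d → 𝔸ˣ) (k : ℕ)
  (hadd : ∀ j < k, ∀ (F G : Site d → Fin d → 𝔸) (z : Site d) (κ : Fin d),
    B7Prop3GeneralLinear.linQcov L (B7Prop2Explicit.avgIter L U₀ j) (F + G) ((L : ℤ) • z) κ =
      B7Prop3GeneralLinear.linQcov L (B7Prop2Explicit.avgIter L U₀ j) F ((L : ℤ) • z) κ +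
        B7Prop3GeneralLinear.linQcov L (B7Prop2Explicit.avgIter L U₀ j) G ((L : ℤ) • z) κ)
  (hsmul : ∀ j < k, ∀ (t : ℂ) (F : Site d → Fin d → 𝔸) (z : Site d) (κ : Fin d),
    B7Prop3GeneralLinear.linQcov L (B7Prop2Explicit.avgIter L U₀ j) (t • F) ((L : ℤ) • z) κ =
      t • B7Prop3GeneralLinear.linQcov L (B7Prop2Explicit.avgIter L U₀ j) F ((L : ℤ) • z) κ)

include hadd hsmul in
/-- **The composed linear part `LʲηQ_j(U₀)·` is affine along every FINITE family of directions**: `LʲηQ_j(U₀)(B + Σ_i s_i D_i) =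
LʲηQ_j(U₀)B + Σ_i s_i·LʲηQ_j(U₀)D_i` (additivity and homogeneity of every factor «Q_{j+1}(U₀) = Q(Ū₀ʲ)Q_j(U₀)»;
`B7Prop5GeneralLinear.linCovIter_line` iterated over the family). [cite: Balaban1985Averaging, p.38 (before (133)), (153) p.41] -/
theorem linCovIter_family {ι : Type*} (s : Finset ι) (coef : ι → ℂ) (D : ι → Site d → Fin d → 𝔸) (B : Site d → Fin d → 𝔸) :
    ∀ j ≤ k, ∀ (x : Site d) (κ : Fin d),
      linCovIter L U₀ (B + ∑ i ∈ s, coef i • D i) j x κ = linCovIter L U₀ B j x κ + ∑ i ∈ s, coef i • linCovIter L U₀ (D i) j x κ := by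
  classical
  induction s using Finset.induction_on with
  | empty => intro j _ x κ; simp
  | insert a s ha ih =>
    intro j hj x κ
    rw [Finset.sum_insert ha, Finset.sum_insert ha]
    have e : B + (coef a • D a + ∑ i ∈ s, coef i • D i) = (B + ∑ i ∈ s, coef i • D i) + coef a • D a := by abel
    rw [e, linCovIter_line L U₀ k hadd hsmul _ _ j hj, ih j hj x κ]
    abel

end Family

/-! ## §2 The line derivative of `C_k(U₀, ·)(c)` along a finite sum of directions is the sum of the line derivatives -/

section LineSum

variable {𝔸 : Type*} [NormedRing 𝔸] [NormedAlgebra ℂ 𝔸] [CompleteSpace 𝔸] [NormOneClass 𝔸]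
  (L : ℕ) (hL : 2 ≤ L) {G : Subgroup 𝔸ˣ} (hG : AvgClosed d L G) (k : ℕ)
  (Ut : Site d → Fin d → 𝔸ˣ) (hUt : ∀ x κ, Ut x κ ∈ G) {α₀ : ℝ} (hα : 0 < α₀)
  (hα3 : C0 d * α₀ ≤ 1 / 3) (hα4 : 4 * α₀ ≤ c2' d L) (h52 : pdev Ut < α₀ * (((L : ℝ) ^ k)⁻¹) ^ 2)

include hL hG hUt hα hα3 hα4 h52 in
/-- **GATEAUX-LINEARITY OF `C_k(U₀, ·)(c)` ON FINITE FAMILIES.**  At a point `B` of sup norm `≤ a` in [4] Prop. 4's regime and for a finite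
family of directions `D_i`, the map `σ ↦ C_k(U₀, B + Σ_i σ_iD_i)(c)` of finitely many complex variables is differentiable at `0` (the composite
(127) is ANALYTIC along bondwise-analytic families, `B7Prop6GeneralAnalytic.prop4_general_analyticAt`; the composed linear part is affine, §1),
hence the line derivative (137) of `C_k(U₀, ·)(c)` at `B` along `Σ_i D_i` is the SUM of the line derivatives along the `D_i`.
[cite: Balaban1985Averaging, Proposition 4 p.38, (127) p.37, (137) p.39, (150) p.40] -/
theorem lineDeriv_CCovIter_sum (B : Site d → Fin d → 𝔸) {a : ℝ} (ha : 0 ≤ a) (hBa : ∀ x κ, ‖B x κ‖ ≤ a)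
    (hsmall : Real.exp (4 * (800 * ((d : ℝ) + 1) ^ 2 * ((d : ℝ) + 4)) * α₀) * (1 + 8 * (131072 * ((d : ℝ) + 1) ^ 2) * ((L : ℝ) ^ k * a)) ≤ 2)
    (hc₃ : 2 * ((L : ℝ) ^ k * a) ≤ c3 d L) {ι : Type*} [Fintype ι] [DecidableEq ι] (D : ι → Site d → Fin d → 𝔸)
    (z : Site d) (κ : Fin d) :
    DifferentiableAt ℂ (fun σ : ι → ℂ => CCovIter L Ut (B + ∑ i, σ i • D i) k z κ) 0 ∧
      lineDeriv ℂ (fun B' => CCovIter L Ut B' k z κ) B (∑ i, D i) = ∑ i, dCov L Ut B (D i) k z κ := by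
  set Φ : (ι → ℂ) → Site d → Fin d → 𝔸 := fun σ => B + ∑ i, σ i • D i with hΦ
  set h : (ι → ℂ) → 𝔸 := fun σ => CCovIter L Ut (Φ σ) k z κ with hh
  have hΦ0 : Φ 0 = B := by simp [hΦ]
  -- the composite is analytic along the family
  have hlog : AnalyticAt ℂ (fun σ => logCovIter L Ut (Φ σ) k z κ) 0 := by
    refine prop4_general_analyticAt L hL hG k Ut hUt hα hα3 hα4 h52 Φ (t₀ := 0) (fun x κ' => ?_) ha
      (fun x κ' => by rw [hΦ0]; exact hBa x κ') hsmall hc₃ k le_rfl z κ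
    have e : (fun σ : ι → ℂ => Φ σ x κ') = fun σ => B x κ' + ∑ i, σ i • D i x κ' := by
      funext σ; simp [hΦ, Finset.sum_apply]
    rw [e]
    exact analyticAt_const.add (Finset.analyticAt_fun_sum _ fun i _ =>
      ((ContinuousLinearMap.proj (R := ℂ) (φ := fun _ : ι => ℂ) i).analyticAt _).smul analyticAt_const)
  -- the composed linear part is affine along the family
  have hlin_eq : ∀ σ : ι → ℂ, linCovIter L Ut (Φ σ) k z κ = linCovIter L Ut B k z κ + ∑ i, σ i • linCovIter L Ut (D i) k z κ :=
    fun σ => linCovIter_family L Ut k (hadd_levels L hL hG k Ut hUt hα hα3 hα4 h52) (hsmul_levels L hL hG k Ut hUt hα hα3 hα4 h52)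
      Finset.univ σ D B k le_rfl z κ
  have hlin : DifferentiableAt ℂ (fun σ => linCovIter L Ut (Φ σ) k z κ) 0 := by
    rw [show (fun σ => linCovIter L Ut (Φ σ) k z κ) = fun σ => linCovIter L Ut B k z κ + ∑ i, σ i • linCovIter L Ut (D i) k z κ
      from funext hlin_eq]
    exact (differentiableAt_const _).add (by fun_prop)
  have hhd : DifferentiableAt ℂ h 0 := hlog.differentiableAt.sub hlin
  refine ⟨hhd, ?_⟩
  -- the line along `Σ_i D_i` is `t ↦ h(t·𝟙)`
  set one : ι → ℂ := fun _ => 1 with hone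
  have hval : ∀ t : ℂ, CCovIter L Ut (B + t • ∑ i, D i) k z κ = h (t • one) := by
    intro t
    simp only [hh, hΦ, hone, Pi.smul_apply, smul_eq_mul, mul_one, Finset.smul_sum]
  have hcomp : HasDerivAt (fun t : ℂ => h (t • one)) (fderiv ℂ h 0 one) 0 := by
    have h1 : HasDerivAt (fun t : ℂ => t • one) one 0 := by
      simpa using (hasDerivAt_id (0 : ℂ)).smul_const one
    have h2 : HasFDerivAt h (fderiv ℂ h 0) ((fun t : ℂ => t • one) 0) := by
      simp only [zero_smul]; exact hhd.hasFDerivAt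
    exact h2.comp_hasDerivAt (0 : ℂ) h1
  have hld : lineDeriv ℂ (fun B' => CCovIter L Ut B' k z κ) B (∑ i, D i) = fderiv ℂ h 0 one := by
    unfold lineDeriv
    simp_rw [hval]
    exact hcomp.deriv
  rw [hld, show one = ∑ i, Pi.single i (1 : ℂ) by rw [Finset.univ_sum_single], map_sum]
  refine Finset.sum_congr rfl fun i _ => ?_
  rw [← hhd.lineDeriv_eq_fderiv]
  -- the partial of `h` along `δ_i` is the line derivative of `C_k` along `D_i`
  have hlinei : ∀ t : ℂ, h (0 + t • Pi.single i (1 : ℂ)) = CCovIter L Ut (B + t • D i) k z κ := by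
    intro t
    simp only [hh, hΦ, zero_add, Pi.smul_apply, smul_eq_mul]
    congr 2
    rw [Finset.sum_eq_single i]
    · simp
    · intro j _ hj; simp [Pi.single_eq_of_ne hj]
    · simp
  unfold dCov lineDeriv
  simp_rw [hlinei]

end LineSum

end Literature.MathematicalPhysics.QuantumFieldTheory.Balaban1983to89.B7Prop5LineDerivFiniteFamily

end
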